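import Mathlib
import Summits.NavierStokesRegularity.FluidComputer.SkewCutCertificate

/-!
# Skew-cut certificate, STEP 2: structure + certified numbers ⇒ the Schur form of every finer
section is coercive (instab3 g3, cell `ns-blowup`, 2026-08-26)

HONEST FRAMING (human ruling D-0035): nothing here is a claim about Navier–Stokes blow-up.
WHAT THIS IS NOT: not NS evidence. This file closes, in the kernel, the one link of the FINITE half
of the skew-cut certificate chain (`selfsim/SKEWCUT-CERT.md` v1.3, Theorem 1′ STEP 2 and STEP 4,
Theorem 2 (i)) that was still prose: how the STRUCTURE of a Galerkin section of the MODEL operator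
«NS linearised about the forced ABC flow» together with the certified number of the certificate
forces the Schur complement of the certified `K`-section inside ANY finer `K′`-section to have a
coercive quadratic form — after which `SkewCutCertificate.det_fromBlocks_mul_det_pos` transports
the sign of `det` and `SkewCutCertificate.exists_eigenvalue_of_det_sign_change` produces a real
Galerkin eigenvalue in the bracket for every `K′`.

## Setting (real block matrices; the reality of all sections is SKEWCUT-CERT (F4))

A finer section `A⁽ᴷ′⁾(x) = x·1 − L_{K′}` is written over the index split
`head ⊕ (shell ⊕ deep)` = (shells `≤ K`) ⊕ (shell `K+1`) ⊕ (shells `K+2 … K′`):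

* `A : Matrix m m ℝ` — the certified head section `A⁽ᴷ⁾(x)`, invertible;
* `B : Matrix m p ℝ`, `C : Matrix p m ℝ` — the ONLY head↔tail couplings, into / out of shell
  `K+1` (locality (F3): the operator is shell-block-tridiagonal), so the head↔tail blocks of the
  finer section are `fromCols B 0` and `fromRows C 0`;
* `D : Matrix (p ⊕ q) (p ⊕ q) ℝ` — the tail block, about which ONE inequality is assumed,
  `∑ᵢ λᵢ vᵢ² − s·(v ⬝ᵥ v) ≤ v ⬝ᵥ D v` (`tail_form_ge_of_structure` derives it from
  `D = diagonal λ + G + F` with `G` skew (F1) and `v ⬝ᵥ F v ≥ −s·(v ⬝ᵥ v)` (F2), `s = √2` by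
  `SkewCutCertificate.abc_strain_form_abs_le`); here `λ_k = x + ν|k|²`.

## Results

* `tail_form_ge_of_structure` — (F1)+(F2) ⇒ the tail inequality.
* `dotProduct_cross_eq` — locality: `v ⬝ᵥ (fromRows C 0 · A⁻¹ · fromCols B 0) v = w ⬝ᵥ (C A⁻¹ B) w`
  with `w` the shell-`K+1` part of `v`.
* `schur_form_ge` — **STEP 2**: if `μ·(w ⬝ᵥ w) ≤ ∑_{shell} λ w² − s·(w ⬝ᵥ w) − w ⬝ᵥ (C A⁻¹ B) w`
  (the SHARP certificate number: `λ_min(Λ_{K+1} − s + Q_K) ≥ μ`, `Q_K = −sym(C_K N_K B_K)`) and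
  `μ ≤ λ_j − s` on the deep tail (the tail constant `x + ν(K+2)² − s`), then the Schur complement
  `Z′ = D − (fromRows C 0) A⁻¹ (fromCols B 0)` satisfies `μ·(v ⬝ᵥ v) ≤ v ⬝ᵥ Z′ v` for all `v`.
* `shell_form_ge_of_cross` — the RELAXED route's input: from the skew split `C_Kᵀ = −B_K + W_K`
  (advection skew blockwise, `W_K` the symmetric stretching block) and the cross-term bound
  `(N a)ᵀa − (N a)ᵀ(W w) ≥ −(σ/2)·wᵀw` delivered by
  `SkewCutRelaxedEnclosure.cross_term_ge_of_enclosure`, the shell hypothesis of `schur_form_ge`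
  holds with any `μ ≤ λᵢ − s − σ/2` (`= m_t − θ_K²` of Theorem 1).
* `shell_form_ge_of_posSemidef` — the SHARP route's input: positive semidefiniteness of the
  certifier's matrix `Λ_{K+1} − s·1 − ½(C A⁻¹ B + (C A⁻¹ B)ᵀ) − μ·1` (certified `≻ 0` by
  `CongruenceDominancePosDef.posDef_sub_smul_of_congr_rowMargin`) gives the shell hypothesis.
* `det_section_mul_det_head_pos` — **Theorem 1′(b)** for the finer section: `0 < det A⁽ᴷ′⁾ · det A⁽ᴷ⁾`.
* `exists_eigenvalue_of_head_sign_change` — sign bookkeeping + Theorem 2(i): if at `x₁ < x₂`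
  `0 < det(xᵢ·1 − L)·det Aᵢ` and `det A₁ · det A₂ < 0`, then `L` has a real eigenvalue in
  `(x₁, x₂)` with a real eigenvector.
* `exists_eigenvalue_of_certificate` — **the finite half of Theorem 2, assembled**: block structure
  of both sections `xᵢ·1 − L` after one fixed re-indexing `head ⊕ (shell ⊕ deep)`, the tail
  inequality, the certified shell numbers and tail constants, and opposite certified head signs
  ⇒ a real eigenvalue of the `K′`-Galerkin matrix `L` in `(x₁, x₂)`. Since the deep-tail type `q`
  is arbitrary (possibly empty), this is the statement for EVERY `K′ > K` at once.
* `injective_of_schur_injective` — the same block algebra with an ARBITRARY (possibly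
  infinite-dimensional) tail module: Theorem 1′(a)'s injectivity of `x − L` once the tail Schur map
  is injective (its form is coercive by the same STEP 2 on the Fourier tail).

What stays outside the kernel after this file: that the ASSEMBLED class-II Galerkin matrices of the
model have this structure (exact by construction of the Fourier–Craya assembly; SKEWCUT-CERT
(F1)–(F4), referee PASS) and the verified arithmetic of the two certifiers (CERTIFIER AUDIT);
Theorem 2(ii) (compactness, passage to the infinite operator) is instab4's
`GalerkinCompactConvergence` lane. Mathlib + `SkewCutCertificate` only; no definitions.
-/

namespace Summit.NavierStokesRegularity.FluidComputer.SkewCutSchurCoercivity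

open Matrix Finset

section Finite

variable {m p q : Type*} [Fintype m] [Fintype p] [Fintype q] [DecidableEq m] [DecidableEq p]
  [DecidableEq q]

/-- A real skew matrix has vanishing quadratic form: `Gᵀ = −G ⇒ v ⬝ᵥ G v = 0` ((F1): the Leray-
projected advection `P(U·∇)` and every compression of it). -/
theorem dotProduct_mulVec_eq_zero_of_transpose_eq_neg {ι : Type*} [Fintype ι] (G : Matrix ι ι ℝ)
    (hG : Gᵀ = -G) (v : ι → ℝ) : v ⬝ᵥ (G *ᵥ v) = 0 := by
  have h1 : v ⬝ᵥ (G *ᵥ v) = -(v ⬝ᵥ (G *ᵥ v)) :=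
    calc v ⬝ᵥ (G *ᵥ v) = (v ᵥ* G) ⬝ᵥ v := dotProduct_mulVec v G v
      _ = (Gᵀ *ᵥ v) ⬝ᵥ v := by rw [mulVec_transpose]
      _ = -(v ⬝ᵥ (G *ᵥ v)) := by rw [hG, neg_mulVec, neg_dotProduct, dotProduct_comm]
  linarith

/-- **Tail inequality from structure (F1)+(F2).** If the tail block is `D = diagonal λ + G + F` with
`G` skew and `v ⬝ᵥ F v ≥ −s·(v ⬝ᵥ v)` (stretching bounded below by `−s`, `s = √2` for `abc(1,1,1)`),
then `∑ᵢ λᵢ vᵢ² − s·(v ⬝ᵥ v) ≤ v ⬝ᵥ D v`. -/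
theorem tail_form_ge_of_structure {ι : Type*} [Fintype ι] [DecidableEq ι] (D G F : Matrix ι ι ℝ)
    (lam : ι → ℝ) (s : ℝ) (hD : D = diagonal lam + G + F) (hG : Gᵀ = -G)
    (hF : ∀ v : ι → ℝ, -(s * (v ⬝ᵥ v)) ≤ v ⬝ᵥ (F *ᵥ v)) (v : ι → ℝ) :
    ∑ i, lam i * v i ^ 2 - s * (v ⬝ᵥ v) ≤ v ⬝ᵥ (D *ᵥ v) := by
  have hdiag : v ⬝ᵥ (diagonal lam *ᵥ v) = ∑ i, lam i * v i ^ 2 := by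
    unfold dotProduct
    refine Finset.sum_congr rfl fun i _ => ?_
    rw [mulVec_diagonal]
    ring
  rw [hD, add_mulVec, add_mulVec, dotProduct_add, dotProduct_add, hdiag,
    dotProduct_mulVec_eq_zero_of_transpose_eq_neg G hG v]
  linarith [hF v]

omit [DecidableEq p] [DecidableEq q] in
/-- Splitting a dot product over the tail index `p ⊕ q` (shell `K+1` ⊕ deeper shells). -/
theorem dotProduct_sum_split (v y : p ⊕ q → ℝ) :
    v ⬝ᵥ y = (fun i => v (Sum.inl i)) ⬝ᵥ (fun i => y (Sum.inl i)) +
      (fun j => v (Sum.inr j)) ⬝ᵥ (fun j => y (Sum.inr j)) := by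
  unfold dotProduct
  rw [Fintype.sum_sum_type]

omit [DecidableEq m] [DecidableEq p] [DecidableEq q] in
/-- **Locality (F3).** With head↔tail couplings supported on shell `K+1` only, the cross term of
the Schur complement sees only the shell part `w = v ∘ inl` of a tail vector:
`v ⬝ᵥ ((fromRows C 0) X (fromCols B 0)) v = w ⬝ᵥ (C X B) w` (here `X = A⁻¹`). -/
theorem dotProduct_cross_eq (X : Matrix m m ℝ) (B : Matrix m p ℝ) (C : Matrix p m ℝ)
    (v : p ⊕ q → ℝ) :
    v ⬝ᵥ ((fromRows C (0 : Matrix q m ℝ) * X * fromCols B (0 : Matrix m q ℝ)) *ᵥ v) =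
      (fun i => v (Sum.inl i)) ⬝ᵥ ((C * X * B) *ᵥ fun i => v (Sum.inl i)) := by
  rw [fromRows_mul, fromRows_mul_fromCols, fromBlocks_mulVec, dotProduct_sum_split]
  simp only [Function.comp_def, Matrix.mul_zero, Matrix.zero_mul, zero_mulVec, add_zero,
    Sum.elim_inl, Sum.elim_inr, dotProduct_zero]

omit [DecidableEq p] [DecidableEq q] in
/-- **STEP 2 of Theorem 1′ (sharp form (I\*)).** Structure: tail inequality `hD`, locality (the
finer section's head↔tail blocks are `fromCols B 0`, `fromRows C 0`). Certified numbers: on shell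
`K+1`, `μ·(w ⬝ᵥ w) ≤ ∑ λ w² − s·(w ⬝ᵥ w) − w ⬝ᵥ (C A⁻¹ B) w` (i.e. `λ_min(Λ_{K+1} − s + Q_K) ≥ μ`,
since `w ⬝ᵥ M w = w ⬝ᵥ sym(M) w`), and `μ ≤ λ_j − s` on the deep tail (`x + ν(K+2)² − s ≥ μ`). Then
the Schur complement `Z′ = D − (fromRows C 0) A⁻¹ (fromCols B 0)` of the head section inside the
finer section has `μ·(v ⬝ᵥ v) ≤ v ⬝ᵥ Z′ v` for every tail vector `v`. -/
theorem schur_form_ge (A : Matrix m m ℝ) [Invertible A] (B : Matrix m p ℝ) (C : Matrix p m ℝ)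
    (D : Matrix (p ⊕ q) (p ⊕ q) ℝ) (lam : p ⊕ q → ℝ) (s μ : ℝ)
    (hD : ∀ v : p ⊕ q → ℝ, ∑ i, lam i * v i ^ 2 - s * (v ⬝ᵥ v) ≤ v ⬝ᵥ (D *ᵥ v))
    (hX : ∀ w : p → ℝ, μ * (w ⬝ᵥ w) ≤
      ∑ i, lam (Sum.inl i) * w i ^ 2 - s * (w ⬝ᵥ w) - w ⬝ᵥ ((C * ⅟A * B) *ᵥ w))
    (hq : ∀ j : q, μ ≤ lam (Sum.inr j) - s) (v : p ⊕ q → ℝ) :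
    μ * (v ⬝ᵥ v) ≤
      v ⬝ᵥ ((D - fromRows C (0 : Matrix q m ℝ) * ⅟A * fromCols B (0 : Matrix m q ℝ)) *ᵥ v) := by
  set w : p → ℝ := fun i => v (Sum.inl i) with hw
  set u : q → ℝ := fun j => v (Sum.inr j) with hu
  have hsum : ∑ i, lam i * v i ^ 2 =
      ∑ i, lam (Sum.inl i) * w i ^ 2 + ∑ j, lam (Sum.inr j) * u j ^ 2 := by
    rw [Fintype.sum_sum_type]
  have hq' : μ * (u ⬝ᵥ u) ≤ ∑ j, lam (Sum.inr j) * u j ^ 2 - s * (u ⬝ᵥ u) := by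
    unfold dotProduct
    rw [Finset.mul_sum, Finset.mul_sum, ← Finset.sum_sub_distrib]
    refine Finset.sum_le_sum fun j _ => ?_
    have := hq j
    nlinarith [mul_self_nonneg (u j)]
  have hDv := hD v
  rw [hsum, dotProduct_sum_split v v] at hDv
  have hXw := hX w
  rw [sub_mulVec, dotProduct_sub, dotProduct_cross_eq, dotProduct_sum_split v v]
  change μ * (w ⬝ᵥ w + u ⬝ᵥ u) ≤ v ⬝ᵥ (D *ᵥ v) - w ⬝ᵥ ((C * ⅟A * B) *ᵥ w)
  change ∑ i, lam (Sum.inl i) * w i ^ 2 + ∑ j, lam (Sum.inr j) * u j ^ 2 -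
      s * (w ⬝ᵥ w + u ⬝ᵥ u) ≤ v ⬝ᵥ (D *ᵥ v) at hDv
  nlinarith [hDv, hXw, hq']

omit [DecidableEq p] in
/-- **The relaxed route's shell input (form (I1)(I2)).** Skew split of the boundary couplings:
`B = E·B_K`, `C = C_K·Eᵀ` through the shell-`K` coordinates `E` of the head, with
`C_Kᵀ = −B_K + W` (advection skew blockwise (F1); `W = W_K` the symmetric stretching block), and
`N := Eᵀ A⁻¹ E` (`= N_K`, the shell-`K` block of the inverse head section). If the cross term obeys
`−(σ/2)·(w ⬝ᵥ w) ≤ (N a) ⬝ᵥ a − (N a) ⬝ᵥ (W w)` for all `a, w` — the conclusion of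
`SkewCutRelaxedEnclosure.cross_term_ge_of_enclosure` (certified `h_K`, `θ_K² ≤ σ/2`) — and
`μ ≤ λᵢ − s − σ/2` on shell `K+1` (`m_t − θ_K² ≥ μ`), then the shell hypothesis `hX` of
`schur_form_ge` holds. -/
theorem shell_form_ge_of_cross {k : Type*} [Fintype k] [DecidableEq k] (A : Matrix m m ℝ)
    [Invertible A] (B : Matrix m p ℝ) (C : Matrix p m ℝ) (E : Matrix m k ℝ) (BK : Matrix k p ℝ)
    (CK : Matrix p k ℝ) (W : Matrix k p ℝ) (lamp : p → ℝ) (s σ μ : ℝ) (hB : B = E * BK)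
    (hC : C = CK * Eᵀ) (hCK : CKᵀ = -BK + W)
    (hcross : ∀ (a : k → ℝ) (w : p → ℝ), -(σ / 2) * (w ⬝ᵥ w) ≤
      ((Eᵀ * ⅟A * E) *ᵥ a) ⬝ᵥ a - ((Eᵀ * ⅟A * E) *ᵥ a) ⬝ᵥ (W *ᵥ w))
    (hp : ∀ i : p, μ ≤ lamp i - s - σ / 2) (w : p → ℝ) :
    μ * (w ⬝ᵥ w) ≤ ∑ i, lamp i * w i ^ 2 - s * (w ⬝ᵥ w) - w ⬝ᵥ ((C * ⅟A * B) *ᵥ w) := by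
  set N : Matrix k k ℝ := Eᵀ * ⅟A * E with hN
  set a : k → ℝ := BK *ᵥ w with ha
  -- the cross term through the skew split
  have hcr : w ⬝ᵥ ((C * ⅟A * B) *ᵥ w) = -((N *ᵥ a) ⬝ᵥ a) + (N *ᵥ a) ⬝ᵥ (W *ᵥ w) := by
    have h1 : C * ⅟A * B = CK * N * BK := by
      rw [hB, hC, hN]; simp only [Matrix.mul_assoc]
    rw [h1, ← mulVec_mulVec, ← mulVec_mulVec, ← ha, dotProduct_mulVec w CK, ← mulVec_transpose,
      hCK, add_mulVec, neg_mulVec, ← ha, add_dotProduct, neg_dotProduct, dotProduct_comm a,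
      dotProduct_comm (W *ᵥ w)]
  have hdiag : μ * (w ⬝ᵥ w) ≤ ∑ i, lamp i * w i ^ 2 - s * (w ⬝ᵥ w) - (σ / 2) * (w ⬝ᵥ w) := by
    unfold dotProduct
    rw [Finset.mul_sum, Finset.mul_sum, Finset.mul_sum, ← Finset.sum_sub_distrib,
      ← Finset.sum_sub_distrib]
    refine Finset.sum_le_sum fun i _ => ?_
    have := hp i
    nlinarith [mul_self_nonneg (w i)]
  rw [hcr]
  linarith [hcross a w, hdiag]

/-- **The sharp route's shell input from the certifier's matrix.** The certifier encloses
`X := Λ_{K+1} − s·1 + Q_K`, `Q_K := −½(C N B + (C N B)ᵀ)` (`N = A⁻¹`; SKEWCUT-CERT §2) and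
certifies `X − μ·1 ≻ 0` by `CongruenceDominancePosDef.posDef_sub_smul_of_congr_rowMargin`; positive
SEMI-definiteness of `X − μ·1` already gives the shell hypothesis `hX` of `schur_form_ge`
(`wᵀMw = ½wᵀ(M + Mᵀ)w`). -/
theorem shell_form_ge_of_posSemidef (A : Matrix m m ℝ) [Invertible A] (B : Matrix m p ℝ)
    (C : Matrix p m ℝ) (lamp : p → ℝ) (s μ : ℝ)
    (hX : (diagonal lamp - s • (1 : Matrix p p ℝ)
      - (1 / 2 : ℝ) • (C * ⅟A * B + (C * ⅟A * B)ᵀ) - μ • (1 : Matrix p p ℝ)).PosSemidef)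
    (w : p → ℝ) :
    μ * (w ⬝ᵥ w) ≤ ∑ i, lamp i * w i ^ 2 - s * (w ⬝ᵥ w) - w ⬝ᵥ ((C * ⅟A * B) *ᵥ w) := by
  have h0 := hX.dotProduct_mulVec_nonneg w
  have hdiag : w ⬝ᵥ (diagonal lamp *ᵥ w) = ∑ i, lamp i * w i ^ 2 := by
    unfold dotProduct
    refine Finset.sum_congr rfl fun i _ => ?_
    rw [mulVec_diagonal]
    ring
  have htr : w ⬝ᵥ ((C * ⅟A * B)ᵀ *ᵥ w) = w ⬝ᵥ ((C * ⅟A * B) *ᵥ w) := by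
    rw [mulVec_transpose, dotProduct_comm, dotProduct_mulVec]
  simp only [sub_mulVec, smul_mulVec, add_mulVec, one_mulVec, dotProduct_sub, dotProduct_smul,
    dotProduct_add, smul_eq_mul, hdiag, htr, star_trivial] at h0
  linarith

/-- **Coercive ⇒ positive definite form** (for `μ > 0`). -/
theorem form_pos_of_ge {ι : Type*} [Fintype ι] (Z : Matrix ι ι ℝ) {μ : ℝ} (hμ : 0 < μ)
    (hZ : ∀ v : ι → ℝ, μ * (v ⬝ᵥ v) ≤ v ⬝ᵥ (Z *ᵥ v)) (v : ι → ℝ) (hv : v ≠ 0) :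
    0 < v ⬝ᵥ (Z *ᵥ v) := by
  have hvv : 0 < v ⬝ᵥ v := by
    rcases Function.ne_iff.mp hv with ⟨i, hi⟩
    calc (0:ℝ) < v i * v i := mul_self_pos.mpr hi
      _ ≤ v ⬝ᵥ v := by
        unfold dotProduct
        exact Finset.single_le_sum (f := fun j => v j * v j) (fun j _ => mul_self_nonneg (v j))
          (Finset.mem_univ i)
  exact lt_of_lt_of_le (mul_pos hμ hvv) (hZ v)

/-- **Theorem 1′(b) for one finer section.** Under the hypotheses of `schur_form_ge` with `μ > 0`,
the finer section `A⁽ᴷ′⁾ = [[A, (B|0)], [(C;0), D]]` is nonsingular and its determinant has the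
sign of `det A⁽ᴷ⁾`: `0 < det A⁽ᴷ′⁾ · det A`. (STEP 2 + `SkewCutCertificate.det_fromBlocks_mul_det_pos`.)
Since `q` (shells `K+2 … K′`) is an arbitrary finite type, this is the statement for EVERY `K′ > K`. -/
theorem det_section_mul_det_head_pos (A : Matrix m m ℝ) [Invertible A] (B : Matrix m p ℝ)
    (C : Matrix p m ℝ) (D : Matrix (p ⊕ q) (p ⊕ q) ℝ) (lam : p ⊕ q → ℝ) (s μ : ℝ) (hμ : 0 < μ)
    (hD : ∀ v : p ⊕ q → ℝ, ∑ i, lam i * v i ^ 2 - s * (v ⬝ᵥ v) ≤ v ⬝ᵥ (D *ᵥ v))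
    (hX : ∀ w : p → ℝ, μ * (w ⬝ᵥ w) ≤
      ∑ i, lam (Sum.inl i) * w i ^ 2 - s * (w ⬝ᵥ w) - w ⬝ᵥ ((C * ⅟A * B) *ᵥ w))
    (hq : ∀ j : q, μ ≤ lam (Sum.inr j) - s) :
    0 < (fromBlocks A (fromCols B (0 : Matrix m q ℝ)) (fromRows C (0 : Matrix q m ℝ)) D).det
      * A.det :=
  SkewCutCertificate.det_fromBlocks_mul_det_pos A _ _ D
    (form_pos_of_ge _ hμ (schur_form_ge A B C D lam s μ hD hX hq))

/-- **Theorem 2(i) assembled for a finer section.** Let `L` be the `K′`-Galerkin matrix (real, over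
`head ⊕ (shell ⊕ deep)`). If at both bracket ends `x₁ < x₂` the section `xᵢ·1 − L` has an
invertible head block `Aᵢ` with `0 < det(xᵢ·1 − L) · det Aᵢ` (e.g. by
`det_section_mul_det_head_pos`) and the certified head signs are opposite, `det A₁ · det A₂ < 0`,
then `L` has a real eigenvalue `x ∈ (x₁, x₂)` with a real eigenvector. -/
theorem exists_eigenvalue_of_head_sign_change {ι : Type*} [Fintype ι] [DecidableEq ι]
    (L : Matrix ι ι ℝ) {x₁ x₂ : ℝ} (hlt : x₁ < x₂) (A₁ A₂ : Matrix m m ℝ)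
    (h₁ : 0 < (x₁ • (1 : Matrix ι ι ℝ) - L).det * A₁.det)
    (h₂ : 0 < (x₂ • (1 : Matrix ι ι ℝ) - L).det * A₂.det) (hsign : A₁.det * A₂.det < 0) :
    ∃ x ∈ Set.Ioo x₁ x₂, ∃ v : ι → ℝ, v ≠ 0 ∧ L *ᵥ v = x • v := by
  apply SkewCutCertificate.exists_eigenvalue_of_det_sign_change L hlt
  -- sign bookkeeping: (d₁ a₁ > 0) ∧ (d₂ a₂ > 0) ∧ (a₁ a₂ < 0) ⇒ d₁ d₂ < 0
  set d₁ := (x₁ • (1 : Matrix ι ι ℝ) - L).det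
  set d₂ := (x₂ • (1 : Matrix ι ι ℝ) - L).det
  set a₁ := A₁.det
  set a₂ := A₂.det
  have h12 : 0 < (d₁ * d₂) * (a₁ * a₂) := by
    have : (d₁ * d₂) * (a₁ * a₂) = (d₁ * a₁) * (d₂ * a₂) := by ring
    rw [this]; exact mul_pos h₁ h₂
  by_contra hge
  have hge : 0 ≤ d₁ * d₂ := not_lt.mp hge
  have : (d₁ * d₂) * (a₁ * a₂) ≤ 0 := mul_nonpos_of_nonneg_of_nonpos hge hsign.le
  linarith

/-- **The finite half of Theorem 2, assembled (sharp form at both ends).** Let `L` be a real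
Galerkin matrix and `e` a FIXED re-indexing of its modes as `head ⊕ (shell ⊕ deep)` (shells `≤ K`,
`K+1`, `K+2 … K′`). Suppose that at both bracket ends `x₁ < x₂` the section `xᵢ·1 − L` is, in these
coordinates, `[[Aᵢ, (Bᵢ|0)], [(Cᵢ;0), Dᵢ]]` (locality (F3)) with `Aᵢ` invertible, tail inequality
(F1)+(F2), certified shell number `hX` and tail constant `hq` with `μᵢ > 0` — and the certified head
determinants have OPPOSITE signs. Then `L` has a real eigenvalue `x ∈ (x₁, x₂)` with a real
eigenvector. (For the relaxed form feed `hX` by `shell_form_ge_of_cross`; for the sharp form by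
`shell_form_ge_of_posSemidef`.) -/
theorem exists_eigenvalue_of_certificate {ι : Type*} [Fintype ι] [DecidableEq ι]
    (L : Matrix ι ι ℝ) (e : ι ≃ m ⊕ (p ⊕ q)) {x₁ x₂ : ℝ} (hlt : x₁ < x₂)
    (A₁ A₂ : Matrix m m ℝ) [Invertible A₁] [Invertible A₂] (B₁ B₂ : Matrix m p ℝ)
    (C₁ C₂ : Matrix p m ℝ) (D₁ D₂ : Matrix (p ⊕ q) (p ⊕ q) ℝ) (lam₁ lam₂ : p ⊕ q → ℝ)
    (s μ₁ μ₂ : ℝ) (hμ₁ : 0 < μ₁) (hμ₂ : 0 < μ₂)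
    (hL₁ : Matrix.reindex e e (x₁ • (1 : Matrix ι ι ℝ) - L) =
      fromBlocks A₁ (fromCols B₁ (0 : Matrix m q ℝ)) (fromRows C₁ (0 : Matrix q m ℝ)) D₁)
    (hL₂ : Matrix.reindex e e (x₂ • (1 : Matrix ι ι ℝ) - L) =
      fromBlocks A₂ (fromCols B₂ (0 : Matrix m q ℝ)) (fromRows C₂ (0 : Matrix q m ℝ)) D₂)
    (hD₁ : ∀ v : p ⊕ q → ℝ, ∑ i, lam₁ i * v i ^ 2 - s * (v ⬝ᵥ v) ≤ v ⬝ᵥ (D₁ *ᵥ v))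
    (hD₂ : ∀ v : p ⊕ q → ℝ, ∑ i, lam₂ i * v i ^ 2 - s * (v ⬝ᵥ v) ≤ v ⬝ᵥ (D₂ *ᵥ v))
    (hX₁ : ∀ w : p → ℝ, μ₁ * (w ⬝ᵥ w) ≤
      ∑ i, lam₁ (Sum.inl i) * w i ^ 2 - s * (w ⬝ᵥ w) - w ⬝ᵥ ((C₁ * ⅟A₁ * B₁) *ᵥ w))
    (hX₂ : ∀ w : p → ℝ, μ₂ * (w ⬝ᵥ w) ≤
      ∑ i, lam₂ (Sum.inl i) * w i ^ 2 - s * (w ⬝ᵥ w) - w ⬝ᵥ ((C₂ * ⅟A₂ * B₂) *ᵥ w))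
    (hq₁ : ∀ j : q, μ₁ ≤ lam₁ (Sum.inr j) - s) (hq₂ : ∀ j : q, μ₂ ≤ lam₂ (Sum.inr j) - s)
    (hsign : A₁.det * A₂.det < 0) :
    ∃ x ∈ Set.Ioo x₁ x₂, ∃ v : ι → ℝ, v ≠ 0 ∧ L *ᵥ v = x • v := by
  have h₁ := det_section_mul_det_head_pos A₁ B₁ C₁ D₁ lam₁ s μ₁ hμ₁ hD₁ hX₁ hq₁
  have h₂ := det_section_mul_det_head_pos A₂ B₂ C₂ D₂ lam₂ s μ₂ hμ₂ hD₂ hX₂ hq₂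
  rw [← hL₁, Matrix.det_reindex_self] at h₁
  rw [← hL₂, Matrix.det_reindex_self] at h₂
  exact exists_eigenvalue_of_head_sign_change L hlt A₁ A₂ h₁ h₂ hsign

end Finite

section Injective

variable {R : Type*} [CommRing R] {EH ET : Type*} [AddCommGroup EH] [Module R EH]
  [AddCommGroup ET] [Module R ET]

/-- **Theorem 1′(a), algebraic core (any tail module, e.g. the infinite Fourier tail).** Let the
operator act blockwise on `head × tail` as `(u_H, u_T) ↦ (A u_H + B u_T, C u_H + D u_T)` with `A`
invertible, and suppose the Schur map `Z = D − C A⁻¹ B` is injective (in the certificate: its form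
is coercive, `Re z(v,v) ≥ μ‖v‖²`, STEP 2). Then the operator is injective: `x − L` has trivial
kernel, so a limit eigenvalue of Theorem 2(ii) cannot sit at a certified bracket end. -/
theorem injective_of_schur_injective (A : EH ≃ₗ[R] EH) (B : ET →ₗ[R] EH) (C : EH →ₗ[R] ET)
    (D : ET →ₗ[R] ET)
    (hZ : Function.Injective (D - C ∘ₗ (A.symm : EH →ₗ[R] EH) ∘ₗ B))
    (uH : EH) (uT : ET) (h₁ : A uH + B uT = 0) (h₂ : C uH + D uT = 0) : uH = 0 ∧ uT = 0 := by
  have huH : uH = -(A.symm (B uT)) := by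
    have : A uH = -(B uT) := eq_neg_of_add_eq_zero_left h₁
    calc uH = A.symm (A uH) := (A.symm_apply_apply uH).symm
      _ = A.symm (-(B uT)) := by rw [this]
      _ = -(A.symm (B uT)) := by rw [map_neg]
  have hZu : (D - C ∘ₗ (A.symm : EH →ₗ[R] EH) ∘ₗ B) uT = 0 := by
    simp only [LinearMap.sub_apply, LinearMap.coe_comp, Function.comp_apply, LinearEquiv.coe_coe]
    rw [huH, map_neg] at h₂
    -- h₂ : -(C (A.symm (B uT))) + D uT = 0
    rw [sub_eq_add_neg, add_comm]
    exact h₂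
  have huT : uT = 0 := hZ (by rw [hZu, map_zero])
  refine ⟨?_, huT⟩
  rw [huH, huT, map_zero, map_zero, neg_zero]

end Injective

end Summit.NavierStokesRegularity.FluidComputer.SkewCutSchurCoercivity
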